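import Mathlib

/-!
# Strategy census gen 2 — companion sketch (planner-cstrat-stmt-MatrixMultiplication-10595-p2-0, 2026-08-17)

Typed statements behind §D26 / §N12 of `STRATEGY-CENSUS.md` gen 2 (crux `ThinBlockAlpha.ThinPackings`,
stmt-MatrixMultiplication-10595): the FREE-DIAGONAL CAPACITY of the non-Latin pattern structure
`S₇ = {002, 020, 200, 011, 101, 110, 111} ⊂ {0,1,2}³` — the seven level patterns of the truncated convolution
`T_ℓ^lower` under the Coppersmith–Winograd level blocking `{0} | [1, ℓ−3] | {ℓ−2}` (the six weight-2 CW patterns plus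
the interior pattern `111`).  Nothing here is proved or claimed; the definitions only pin down the object named in the
census so that a critic / disprover / kit seat can attack it (§T11: the "onion" recursion certifies ω → 2 iff free
diagonals of typed `S₇`-structures beat the Gilbert–Varshamov count `2^{N·I(L_X ; L_Y L_Z)}`).
-/

set_option linter.dupNamespace false

namespace Summit.MatrixMultiplication.MatrixMultiplication.Cruxes.ThinPackings.CensusP2

open Finset

/-- The seven supported level patterns of `T_ℓ^lower` under the CW level blocking (x-level, y-level, z-level with the
z-levels reversed as in the tree's `slicedSTPP_two_le_weight`). -/
def S7 : Finset (Fin 3 × Fin 3 × Fin 3) :=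
  {(0, 0, 2), (0, 2, 0), (2, 0, 0), (0, 1, 1), (1, 0, 1), (1, 1, 0), (1, 1, 1)}

/-- A block triple `(I, J, K)` of level words of length `N`. -/
abbrev Triple (N : ℕ) := (Fin N → Fin 3) × (Fin N → Fin 3) × (Fin N → Fin 3)

/-- `(I, J, K)` is supported: every coordinate pattern lies in `S7`. -/
def Supported {N : ℕ} (I J K : Fin N → Fin 3) : Prop := ∀ t, (I t, J t, K t) ∈ S7

/-- Number of coordinates of `δ` carrying pattern `p`. -/
def patternCount {N : ℕ} (δ : Triple N) (p : Fin 3 × Fin 3 × Fin 3) : ℕ :=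
  (univ.filter fun t => (δ.1 t, δ.2.1 t, δ.2.2 t) = p).card

/-- Symmetric typing of the onion ansatz: patterns `011,101,110` occur `na` times each, `002,020,200` occur `nb` times
each, `111` occurs `nc` times (so `N = 3na + 3nb + nc`, and every leg has `na + 2nb` zeros, `2na + nc` ones, `nb` twos). -/
def Typed {N : ℕ} (na nb nc : ℕ) (δ : Triple N) : Prop :=
  patternCount δ (0, 1, 1) = na ∧ patternCount δ (1, 0, 1) = na ∧ patternCount δ (1, 1, 0) = na ∧
  patternCount δ (0, 0, 2) = nb ∧ patternCount δ (0, 2, 0) = nb ∧ patternCount δ (2, 0, 0) = nb ∧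
  patternCount δ (1, 1, 1) = nc

/-- A FREE DIAGONAL: a set of typed supported triples such that the only supported triple whose three legs are legs
of members is a member read diagonally (this contains the matching condition: two members sharing a leg give a supported
mixed triple). Exactly the object the laser method extracts by Salem–Spencer hashing when the structure is Latin. -/
def IsFreeDiagonal {N : ℕ} (na nb nc : ℕ) (Δ : Finset (Triple N)) : Prop :=
  (∀ δ ∈ Δ, Typed na nb nc δ ∧ Supported δ.1 δ.2.1 δ.2.2) ∧
  ∀ δ ∈ Δ, ∀ δ' ∈ Δ, ∀ δ'' ∈ Δ, Supported δ.1 δ'.2.1 δ''.2.2 → δ = δ' ∧ δ' = δ''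

/-- Binary entropy in nats (for the capacity exponent). -/
noncomputable def h2 (x : ℝ) : ℝ := -(x * Real.log x + (1 - x) * Real.log (1 - x))

/-- Entropy of the leg level law `(a + 2b, 2a + c, b)` in nats. -/
noncomputable def legEntropy (a b c : ℝ) : ℝ :=
  -((a + 2 * b) * Real.log (a + 2 * b) + (2 * a + c) * Real.log (2 * a + c) + b * Real.log b)

/-- §N12 as a statement to PROVE (barrier target) or REFUTE (onion door): **non-Latin capacity bound with loss
fraction `κ`.**  For the frequencies `(a, b, c)` (with `3a + 3b + c = 1`), every free diagonal of the typed `S₇`-structure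
has size at most `exp(N · (legEntropy − κ · (a+c) · h2 (a/(a+c))) + o(N))`.  `κ = 1` is the "Gilbert–Varshamov level"
(the price of random selection with alteration, census §T11); `κ = 0` is the support-functional (entropy) bound; the census shows
that at `κ = 1` the onion recursion equals the tight-only laser bound identically and at `κ = 0` it certifies
`ω(ℓ) ≈ 2 + 1.65 / log₂ ℓ → 2`. -/
def NonLatinCapacityBound (κ : ℝ) : Prop :=
  ∀ a b c : ℝ, 0 < a → 0 ≤ b → 0 < c → 3 * a + 3 * b + c = 1 →
    ∀ η : ℝ, 0 < η → ∃ N₀ : ℕ, ∀ N ≥ N₀, ∀ na nb nc : ℕ,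
      |(na : ℝ) - a * N| ≤ 1 → |(nb : ℝ) - b * N| ≤ 1 → |(nc : ℝ) - c * N| ≤ 1 →
      ∀ Δ : Finset (Triple N), IsFreeDiagonal na nb nc Δ →
        (Δ.card : ℝ) ≤ Real.exp (N * (legEntropy a b c - κ * (a + c) * h2 (a / (a + c)) + η))

/-- §D26's open half `X₂` (the onion door): the entropy bound is achievable up to `exp(o(N))` — the negation-in-spirit of
`NonLatinCapacityBound κ` for every `κ > 0`. -/
def FreeDiagonalCapacityS7 : Prop :=
  ∀ a b c : ℝ, 0 < a → 0 ≤ b → 0 < c → 3 * a + 3 * b + c = 1 →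
    ∀ η : ℝ, 0 < η → ∃ N₀ : ℕ, ∀ N ≥ N₀, ∃ (na nb nc : ℕ) (Δ : Finset (Triple N)),
      |(na : ℝ) - a * N| ≤ 1 ∧ |(nb : ℝ) - b * N| ≤ 1 ∧ |(nc : ℝ) - c * N| ≤ 1 ∧
      IsFreeDiagonal na nb nc Δ ∧ Real.exp (N * (legEntropy a b c - η)) ≤ (Δ.card : ℝ)

/-- Sanity: `S7` has seven patterns. -/
example : S7.card = 7 := by decide

/-- Sanity: `S7` is not Latin in the direction `(x, y) ↦ z` — `110` and `111` share the first two legs. -/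
example : ((1 : Fin 3), (1 : Fin 3), (0 : Fin 3)) ∈ S7 ∧ ((1 : Fin 3), (1 : Fin 3), (1 : Fin 3)) ∈ S7 := by decide

end Summit.MatrixMultiplication.MatrixMultiplication.Cruxes.ThinPackings.CensusP2
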